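import Summits.QuantumFields.YangMills.Theorems.BalabanUVNodesN22WindowOfLocalTerms
import Literature.MathematicalPhysics.QuantumFieldTheory.Balaban1983to89.Node00.U3KernelLetters2

/-!
# BalabanUVNodes ∕ N18 — SUPERPOSITION: def-B's (1.20)–(1.21) maps and node U3's W1-19b ∕ W1-19c kernel letters under SUMS OF TERM FAMILIES
# (the letters are a CONE in the term family: every letter of `ℰ₁ + ℰ₂` from the letters of `ℰ₁`, `ℰ₂`, constants ∕ moduli ADDED, rates shared)
# (Track A, DAG node N18 = NE5; key K3⁷ `SpineGivenEndpointR13SepCoPH` = stmt-QuantumFields-20544, skeleton v5 941dddb108cbaacf; cell `pub-ymgap`, WIDTH SEAT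
# `pub-ymgap-dag-n18-w2` g8; `--kind proof --supports stmt-QuantumFields-20544 --as helper`, COUNT-NEUTRAL; THEOREMS ONLY, 0 `def`, 0 `sorry`)

WHY.  Since K3⁷ v3 node U3 is PINNED to def-W1's kernel objects `U3OfKernels.objects F ℰ ρ bV ℓ` of ONE term family `ℰ : Node00.TermFamily1 F 𝔄` run through
def-B's maps — the (1.20) Hessian of the exponential chart (`polScalar`), the window into `ℤ⁴` (`polWindow`), the (1.21) limit «T^{(k+1)} ↗ Z^d» (`polLimit`,
`kernelA`) — and W1-19b (`Node00/U3KernelLetters`) names the finite-volume INPUT letters of that family.  Every road that assembles the merged term (1.6) from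
SPECIES of terms — [I] (1.6)∕(1.7), [II] (2.12)–(2.14) («E^{(k+1)} = log Z^{(k)} + (2.13)», the coupling-free Gaussian normalisation plus the remainder), the
boundary ∕ large-field species of [Balaban1988Convergent] (2.24)–(2.25) (dag-n19-c's census `…N19OtherKindsSpecies` §A in FUNCTIONAL currency: `ne9_add`,
`decayBound_add`, `ne5_add`) — needs the letters to be a CONE IN THE TERM FAMILY.  dag-n22-c's J27 (`…N22WindowOfLocalTerms`) gave the finite-volume half for a
`Finset` of terms of ONE family (`polTensor_finset_sum`, `polScalar_finset_sum`).  THIS FILE carries additivity through the window, the limit (1.21) and every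
W1-19b ∕ W1-19c letter, and to W1-19's functionals `EA` at the kernel objects, for two term families `ℰ₁, ℰ₂` whose charts are twice continuously differentiable
at `0` ([I] p. 264 «analytic … uniformly bounded … together with all derivatives»).

WHAT (hypotheses `hC₁ hC₂ : ∀ k hist K, ContDiffAt ℝ 2 (expChart (ℰᵢ k hist K) ρ) 0` throughout; `ℰ₁ + ℰ₂` is the pointwise sum, `(ℰ₁ + ℰ₂) k hist K W =
ℰ₁ k hist K W + ℰ₂ k hist K W` by `rfl`).
* §1 (finite volume, any functional on a finite torus): `polTensor_add` (J27's `polTensor_finset_sum` at two summands) · `expChart_add` · ★ `polScalar_add` ·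
  ★ `polWindow_add` · `polWindow_finset_sum`.
* §2 (the (1.21) limit of a `K`-indexed family): `tendsto_polWindow_add` · ★ `polLimitExists_add` · ★ `polLimit_add` (under `PolLimitExists` for BOTH summands:
  `Filter.Tendsto.add` + uniqueness of `limUnder` — NO convergence is used beyond the displayed existence) · `polLimit_add_apply`; for term families:
  ★ `kernelA_add` (W1-19's limiting kernels add wherever both (1.21) limits exist) · `kernelA_add_of_polLimitsExist` (on a window carrying `PolLimitsExist`).
* §3 THE LETTER CONE (term families, W1-19b `Node00/U3KernelLetters` + W1-19c `Node00/U3KernelLetters2` + W1-19 `U3OfKernels`): ★ `polLimitsExist_add` ·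
  `polLimitsExistBox_add` · ★ `windowedDecay_add` · `windowedDecayUniform_add` (`E₁ + E₂`) · ★ `windowedNE9_add` (moduli `Λ₁ + Λ₂`) · ★ `geometricIncrements_add`
  (same ratio `r`) · ★ `windowedStepRate_add` (`C'₁ + C'₂`, same `γ s κ θ`) · ★★ `kernelStepRate_add` (node N18's letter, `C₅¹ + C₅²`, given `PolLimitsExist` on
  `Window γ` for both) · `kernelDecay_add` ((D4)'s class letter) · `decayBound_EA_add` (W1-19's (UD) slot `DecayBound (EA F (ℰ₁+ℰ₂) ρ bV) W (E₁+E₂) κ`) ·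
  `ne9_EA_add` (`NE9 (EA F (ℰ₁+ℰ₂) ρ bV) W κ (Λ₁+Λ₂)`) · `ne5_EA_EB_add` (W1-19's `NE5` per first coupling).
A6 ∕ HONEST SCOPE.  Schema lemmas (implications between DISPLAYED letters of two arbitrary term families); the antecedents are jointly inhabited — trivially by
constant families, NON-TRIVIALLY at model level by sums of dag-n18-w2 g7's two-bond families (`…N18RunningBetaLettersModelNodes`: every letter at every
`crossTermFamily F a e` from letters on the law `a`), typed in the β-side sequel `…N18BetaSuperposition` (INTENT-2 of this seat).  Nothing here inhabits a
letter OF RECORD.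

HONEST FRAMING — what this is NOT.  Count-neutral calculus ∕ filter bookkeeping (linearity of `fderiv` near `0`, `Tendsto.add`, the triangle inequality);
NO estimate of Bałaban's is proved or asserted; nothing of the merged term (1.6) ∕ the (2.13) terms of record is constructed (NODE A ∕ N10 ∕ def-W1's
`Localizes17OfRecord₁₃`); NE5 ∕ NE9 at finite volume NOT PRINTED for d = 4; N18 ∕ N22 ∕ (D4) NOT discharged; K3⁷ OPEN, not claimed; counts UNMOVED (typed 28∕28
· discharged 5∕27 (A 5∕28)); one finite four-torus programme at fixed ε, Bałaban AS PRINTED; R4 closes the conditional finite-𝕋⁴ rung `BalabanLadder.UV` only —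
NOT ℝ⁴, NOT infinite volume, NOT OS, NOT a mass gap; the Clay problem is NOT proved by any of this.

References (TYPES only): [I] = [Balaban1987RG1] (1.6)–(1.7) p. 261, (1.18) p. 263, (1.20)–(1.21) p. 264, Thm 1 p. 259, (5.10) p. 293; [II] =
[Balaban1988RG2Cluster] (2.12)–(2.14) pp. 14–15; [Balaban1988Convergent] (2.24)–(2.25) p. 259 (species).  Imports J27 `…N22WindowOfLocalTerms` (dag-n22-c) and
def-W1's `Node00/U3KernelLetters2` (⊇ `U3KernelLetters`, `U3OfKernels`, `BetaOfRecord`) BY NAME; nothing re-declared.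
-/

noncomputable section

namespace YMDAG.N18.KernelLettersSuperposition

open Filter
open scoped BigOperators Topology
open Literature.MathematicalPhysics.QuantumFieldTheory.Balaban1983to89
open Literature.MathematicalPhysics.QuantumFieldTheory.Balaban1983to89.T4Continuum (T4Family)
open Literature.MathematicalPhysics.QuantumFieldTheory.Balaban1983to89.T4OutputRate (Window DecayBound NE9 NE5)
open Literature.MathematicalPhysics.QuantumFieldTheory.Balaban1983to89.B12Sec2to5 (l1 Decay510)
open Literature.MathematicalPhysics.QuantumFieldTheory.Balaban1983to89.FlowStep (Box)
open Literature.MathematicalPhysics.QuantumFieldTheory.Balaban1983to89.B12PolarizationTensor120 (polTensor polComp expChart)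
open Literature.MathematicalPhysics.QuantumFieldTheory.Balaban1983to89.Node00 (TermFamily1 siteOfInt polScalar polWindow polLimit PolLimitExists prependCoupling)
open Literature.MathematicalPhysics.QuantumFieldTheory.Balaban1983to89.Node00.U3OfKernels (histPrefix kernelA EA EB KernelDecay prependCoupling_mem_window
  decayBound_EA_iff ne9_EA_iff ne5_iff)
open Literature.MathematicalPhysics.QuantumFieldTheory.Balaban1983to89.Node00.U3KernelLetters (PolLimitsExist PolLimitsExistBox WindowedDecay WindowedNE9
  GeometricIncrements WindowedStepRate KernelStepRate)
open Literature.MathematicalPhysics.QuantumFieldTheory.Balaban1983to89.Node00.U3KernelLetters2 (WindowedDecayUniform)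
open YMDAG.N22.WindowOfLocalTerms (polTensor_finset_sum)

/-! ## §1 Finite volume: the (1.20) Hessian, def-B's scalar kernel and the window of a SUM of two functionals -/

section FiniteVolume

variable {𝔄 : Type*} [NormedRing 𝔄] [NormedAlgebra ℝ 𝔄] {V : Type*} [NormedAddCommGroup V] [NormedSpace ℝ V] {ι : Type*} [Fintype ι]
  {Λ T : Type*} [Fintype Λ] [Fintype T] [DecidableEq Λ] [DecidableEq T] {F' : Type*} [NormedAddCommGroup F'] [NormedSpace ℝ F']

/-- **(1.20) IS ADDITIVE IN THE FUNCTIONAL** (two summands, each twice continuously differentiable at `0`): J27's `polTensor_finset_sum` over `Fin 2`.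
[cite: Balaban1987RG1, (1.20) p.264 and (1.7) p.261] -/
theorem polTensor_add (𝓔₁ 𝓔₂ : (Λ → T → V) → F') (h₁ : ContDiffAt ℝ 2 𝓔₁ 0) (h₂ : ContDiffAt ℝ 2 𝓔₂ 0)
    (μ : Λ) (x : T) (v : V) (ν : Λ) (y : T) (w : V) :
    polTensor ℝ (fun B => 𝓔₁ B + 𝓔₂ B) μ x v ν y w = polTensor ℝ 𝓔₁ μ x v ν y w + polTensor ℝ 𝓔₂ μ x v ν y w := by
  have h := polTensor_finset_sum ℝ (Finset.univ : Finset (Fin 2)) ![𝓔₁, 𝓔₂] (fun X _ => by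
    fin_cases X
    · exact h₁
    · exact h₂) μ x v ν y w
  simpa [Fin.sum_univ_two] using h

omit [Fintype Λ] [Fintype T] [DecidableEq Λ] [DecidableEq T] in
/-- The exponential chart of a sum of two functionals is the sum of the charts (pointwise; `expChart ℰ ρ B = ℰ(exp ρB)`). [cite: Balaban1987RG1, p.264 (before (1.20))] -/
theorem expChart_add (ℰ₁ ℰ₂ : (Λ → T → 𝔄) → ℝ) (ρ : V →L[ℝ] 𝔄) :
    expChart (fun U => ℰ₁ U + ℰ₂ U) ρ = fun B => expChart ℰ₁ ρ B + expChart ℰ₂ ρ B := by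
  funext B; simp only [B12PolarizationTensor120.expChart_apply]

/-- ★ **def-B's SCALAR KERNEL IS ADDITIVE IN THE FUNCTIONAL** (the normalised colour trace of `polComp` of the exponential chart; both charts `C²` at `0`).
[cite: Balaban1987RG1, (1.20)–(1.21) p.264] -/
theorem polScalar_add (ℰ₁ ℰ₂ : (Λ → T → 𝔄) → ℝ) (ρ : V →L[ℝ] 𝔄) (bV : Module.Basis ι ℝ V)
    (h₁ : ContDiffAt ℝ 2 (expChart ℰ₁ ρ) 0) (h₂ : ContDiffAt ℝ 2 (expChart ℰ₂ ρ) 0) (μ : Λ) (x : T) (ν : Λ) (y : T) :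
    polScalar (fun U => ℰ₁ U + ℰ₂ U) ρ bV μ x ν y = polScalar ℰ₁ ρ bV μ x ν y + polScalar ℰ₂ ρ bV μ x ν y := by
  simp only [polScalar, polComp, expChart_add, polTensor_add _ _ h₁ h₂, Finset.sum_add_distrib, mul_add]

variable (F : T4Family)

/-- ★ **def-B's WINDOWED KERNEL IS ADDITIVE IN THE FUNCTIONAL**: on the `K`-th torus, at every direction pair and every integer separation,
`Π^{(K)}[ℰ₁ + ℰ₂](z) = Π^{(K)}[ℰ₁](z) + Π^{(K)}[ℰ₂](z)`. [cite: Balaban1987RG1, (1.20)–(1.21) p.264] -/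
theorem polWindow_add (K j : ℕ) (ℰ₁ ℰ₂ : (Fin (F.P K).d → Site (F.P K) j → 𝔄) → ℝ) (ρ : V →L[ℝ] 𝔄) (bV : Module.Basis ι ℝ V)
    (h₁ : ContDiffAt ℝ 2 (expChart ℰ₁ ρ) 0) (h₂ : ContDiffAt ℝ 2 (expChart ℰ₂ ρ) 0) (μ ν : Fin 4) (z : Fin 4 → ℤ) :
    polWindow F K j (fun U => ℰ₁ U + ℰ₂ U) ρ bV μ ν z = polWindow F K j ℰ₁ ρ bV μ ν z + polWindow F K j ℰ₂ ρ bV μ ν z := by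
  unfold polWindow
  exact polScalar_add ℰ₁ ℰ₂ ρ bV h₁ h₂ _ _ _ _

/-- The windowed kernel of a FINITE SUM of functionals is the sum of the windowed kernels (J27's `polScalar_finset_sum` read through the window).
[cite: Balaban1987RG1, (1.7) p.261 and (1.20)–(1.21) p.264] -/
theorem polWindow_finset_sum {𝒳 : Type*} (K j : ℕ) (s : Finset 𝒳) (ℰ : 𝒳 → (Fin (F.P K).d → Site (F.P K) j → 𝔄) → ℝ) (ρ : V →L[ℝ] 𝔄)
    (bV : Module.Basis ι ℝ V) (hℰ : ∀ X ∈ s, ContDiffAt ℝ 2 (expChart (ℰ X) ρ) 0) (μ ν : Fin 4) (z : Fin 4 → ℤ) :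
    polWindow F K j (fun U => ∑ X ∈ s, ℰ X U) ρ bV μ ν z = ∑ X ∈ s, polWindow F K j (ℰ X) ρ bV μ ν z := by
  unfold polWindow
  exact YMDAG.N22.WindowOfLocalTerms.polScalar_finset_sum s ℰ ρ bV hℰ _ _ _ _

end FiniteVolume

/-! ## §2 The (1.21) limit «T^{(k+1)} ↗ Z^d» of a sum: existence and value, under `PolLimitExists` for both summands -/

section Limit

variable {𝔄 : Type*} [NormedRing 𝔄] [NormedAlgebra ℝ 𝔄] {V : Type*} [NormedAddCommGroup V] [NormedSpace ℝ V] {ι : Type*} [Fintype ι]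
variable (F : T4Family) (j : ℕ) (ℰ₁ ℰ₂ : (K : ℕ) → (Fin (F.P K).d → Site (F.P K) j → 𝔄) → ℝ) (ρ : V →L[ℝ] 𝔄) (bV : Module.Basis ι ℝ V)

/-- If the windowed kernels of both `K`-families converge, those of the sum converge to the sum of the limits. [cite: Balaban1987RG1, (1.21) p.264] -/
theorem tendsto_polWindow_add (hC₁ : ∀ K, ContDiffAt ℝ 2 (expChart (ℰ₁ K) ρ) 0) (hC₂ : ∀ K, ContDiffAt ℝ 2 (expChart (ℰ₂ K) ρ) 0)
    {μ ν : Fin 4} {z : Fin 4 → ℤ} {P₁ P₂ : ℝ} (h₁ : Tendsto (fun K : ℕ => polWindow F K j (ℰ₁ K) ρ bV μ ν z) atTop (𝓝 P₁))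
    (h₂ : Tendsto (fun K : ℕ => polWindow F K j (ℰ₂ K) ρ bV μ ν z) atTop (𝓝 P₂)) :
    Tendsto (fun K : ℕ => polWindow F K j (fun U => ℰ₁ K U + ℰ₂ K U) ρ bV μ ν z) atTop (𝓝 (P₁ + P₂)) := by
  have h : (fun K : ℕ => polWindow F K j (fun U => ℰ₁ K U + ℰ₂ K U) ρ bV μ ν z) =
      fun K : ℕ => polWindow F K j (ℰ₁ K) ρ bV μ ν z + polWindow F K j (ℰ₂ K) ρ bV μ ν z :=
    funext fun K => polWindow_add F K j (ℰ₁ K) (ℰ₂ K) ρ bV (hC₁ K) (hC₂ K) μ ν z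
  rw [h]
  exact h₁.add h₂

/-- ★ **«THIS LIMIT EXISTS» IS ADDITIVE**: def-B's named existence property (1.21) for both `K`-families gives it for the sum. [cite: Balaban1987RG1, (1.21) p.264] -/
theorem polLimitExists_add (hC₁ : ∀ K, ContDiffAt ℝ 2 (expChart (ℰ₁ K) ρ) 0) (hC₂ : ∀ K, ContDiffAt ℝ 2 (expChart (ℰ₂ K) ρ) 0)
    (h₁ : PolLimitExists F j ℰ₁ ρ bV) (h₂ : PolLimitExists F j ℰ₂ ρ bV) :
    PolLimitExists F j (fun K U => ℰ₁ K U + ℰ₂ K U) ρ bV := fun μ ν z => by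
  obtain ⟨P₁, hP₁⟩ := h₁ μ ν z
  obtain ⟨P₂, hP₂⟩ := h₂ μ ν z
  exact ⟨P₁ + P₂, tendsto_polWindow_add F j ℰ₁ ℰ₂ ρ bV hC₁ hC₂ hP₁ hP₂⟩

/-- ★ **THE (1.21) LIMITING KERNEL IS ADDITIVE** under the existence property for BOTH summands (as `ℤ⁴`-kernels; `limUnder` of a convergent sequence is its limit —
no convergence is used beyond the two displayed existence properties). [cite: Balaban1987RG1, (1.21) p.264] -/
theorem polLimit_add (hC₁ : ∀ K, ContDiffAt ℝ 2 (expChart (ℰ₁ K) ρ) 0) (hC₂ : ∀ K, ContDiffAt ℝ 2 (expChart (ℰ₂ K) ρ) 0)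
    (h₁ : PolLimitExists F j ℰ₁ ρ bV) (h₂ : PolLimitExists F j ℰ₂ ρ bV) :
    polLimit F j (fun K U => ℰ₁ K U + ℰ₂ K U) ρ bV = polLimit F j ℰ₁ ρ bV + polLimit F j ℰ₂ ρ bV := by
  funext μ ν z
  exact (tendsto_polWindow_add F j ℰ₁ ℰ₂ ρ bV hC₁ hC₂ (Node00.tendsto_polLimit F j ℰ₁ ρ bV h₁ μ ν z)
    (Node00.tendsto_polLimit F j ℰ₂ ρ bV h₂ μ ν z)).limUnder_eq

/-- Entrywise form of `polLimit_add`. [cite: Balaban1987RG1, (1.21) p.264] -/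
theorem polLimit_add_apply (hC₁ : ∀ K, ContDiffAt ℝ 2 (expChart (ℰ₁ K) ρ) 0) (hC₂ : ∀ K, ContDiffAt ℝ 2 (expChart (ℰ₂ K) ρ) 0)
    (h₁ : PolLimitExists F j ℰ₁ ρ bV) (h₂ : PolLimitExists F j ℰ₂ ρ bV) (μ ν : Fin 4) (z : Fin 4 → ℤ) :
    polLimit F j (fun K U => ℰ₁ K U + ℰ₂ K U) ρ bV μ ν z = polLimit F j ℰ₁ ρ bV μ ν z + polLimit F j ℰ₂ ρ bV μ ν z := by
  rw [polLimit_add F j ℰ₁ ℰ₂ ρ bV hC₁ hC₂ h₁ h₂]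
  rfl

end Limit

section Kernels

variable {𝔄 : Type*} [NormedRing 𝔄] [NormedAlgebra ℝ 𝔄] {V : Type*} [NormedAddCommGroup V] [NormedSpace ℝ V] {ι : Type*} [Fintype ι]
variable (F : T4Family) (ℰ₁ ℰ₂ : TermFamily1 F 𝔄) (ρ : V →L[ℝ] 𝔄) (bV : Module.Basis ι ℝ V)

omit [NormedRing 𝔄] [NormedAlgebra ℝ 𝔄] in
/-- The sum family unfolds pointwise (`rfl`). [cite: Balaban1987RG1, (1.6)–(1.7) p.261 (bookkeeping)] -/
theorem add_apply (k : ℕ) (hist : Fin (k + 1) → ℝ) (K : ℕ) :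
    (ℰ₁ + ℰ₂) k hist K = fun U => ℰ₁ k hist K U + ℰ₂ k hist K U := rfl

/-- ★ **W1-19's LIMITING KERNELS ADD** at every coupling sequence and level where both (1.21) limits exist:
`Π_{k+1}[ℰ₁ + ℰ₂](g; ·) = Π_{k+1}[ℰ₁](g; ·) + Π_{k+1}[ℰ₂](g; ·)`. [cite: Balaban1987RG1, (1.21) p.264] -/
theorem kernelA_add (hC₁ : ∀ k hist K, ContDiffAt ℝ 2 (expChart (ℰ₁ k hist K) ρ) 0) (hC₂ : ∀ k hist K, ContDiffAt ℝ 2 (expChart (ℰ₂ k hist K) ρ) 0)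
    {g : ℕ → ℝ} {k : ℕ} (h₁ : PolLimitExists F (k + 1) (fun K => ℰ₁ k (histPrefix g k) K) ρ bV)
    (h₂ : PolLimitExists F (k + 1) (fun K => ℰ₂ k (histPrefix g k) K) ρ bV) :
    kernelA F (ℰ₁ + ℰ₂) ρ bV g k = kernelA F ℰ₁ ρ bV g k + kernelA F ℰ₂ ρ bV g k := by
  simp only [Node00.U3OfKernels.kernelA_eq]
  exact polLimit_add F (k + 1) _ _ ρ bV (fun K => hC₁ k _ K) (fun K => hC₂ k _ K) h₁ h₂

/-- `kernelA_add` on a window carrying W1-19b's existence letter for both summands. [cite: Balaban1987RG1, (1.21) p.264] -/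
theorem kernelA_add_of_polLimitsExist (hC₁ : ∀ k hist K, ContDiffAt ℝ 2 (expChart (ℰ₁ k hist K) ρ) 0)
    (hC₂ : ∀ k hist K, ContDiffAt ℝ 2 (expChart (ℰ₂ k hist K) ρ) 0) {W : Set (ℕ → ℝ)} (h₁ : PolLimitsExist F ℰ₁ ρ bV W)
    (h₂ : PolLimitsExist F ℰ₂ ρ bV W) {g : ℕ → ℝ} (hg : g ∈ W) (k : ℕ) :
    kernelA F (ℰ₁ + ℰ₂) ρ bV g k = kernelA F ℰ₁ ρ bV g k + kernelA F ℰ₂ ρ bV g k :=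
  kernelA_add F ℰ₁ ℰ₂ ρ bV hC₁ hC₂ (h₁ g hg k) (h₂ g hg k)

/-! ## §3 THE LETTER CONE: every W1-19b ∕ W1-19c letter of `ℰ₁ + ℰ₂` from the letters of `ℰ₁` and `ℰ₂` -/

/-- ★ **(1.21) EXISTS ON THE WINDOW** is additive. [cite: Balaban1987RG1, (1.21) p.264] -/
theorem polLimitsExist_add (hC₁ : ∀ k hist K, ContDiffAt ℝ 2 (expChart (ℰ₁ k hist K) ρ) 0) (hC₂ : ∀ k hist K, ContDiffAt ℝ 2 (expChart (ℰ₂ k hist K) ρ) 0)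
    {W : Set (ℕ → ℝ)} (h₁ : PolLimitsExist F ℰ₁ ρ bV W) (h₂ : PolLimitsExist F ℰ₂ ρ bV W) : PolLimitsExist F (ℰ₁ + ℰ₂) ρ bV W :=
  fun g hg k => polLimitExists_add F (k + 1) _ _ ρ bV (fun K => hC₁ k _ K) (fun K => hC₂ k _ K) (h₁ g hg k) (h₂ g hg k)

/-- **(1.21) EXISTS ON THE BOXES** is additive. [cite: Balaban1987RG1, (1.21) p.264] -/
theorem polLimitsExistBox_add (hC₁ : ∀ k hist K, ContDiffAt ℝ 2 (expChart (ℰ₁ k hist K) ρ) 0) (hC₂ : ∀ k hist K, ContDiffAt ℝ 2 (expChart (ℰ₂ k hist K) ρ) 0)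
    {γ : ℝ} (h₁ : PolLimitsExistBox F ℰ₁ ρ bV γ) (h₂ : PolLimitsExistBox F ℰ₂ ρ bV γ) : PolLimitsExistBox F (ℰ₁ + ℰ₂) ρ bV γ :=
  fun k v hv => polLimitExists_add F (k + 1) _ _ ρ bV (fun K => hC₁ k v K) (fun K => hC₂ k v K) (h₁ k v hv) (h₂ k v hv)

/-- ★ **WINDOWED (5.10) DECAY** is additive (constants per coupling sequence add; rate shared). [cite: Balaban1987RG1, (5.10) p.293 and (1.20) p.264] -/
theorem windowedDecay_add (hC₁ : ∀ k hist K, ContDiffAt ℝ 2 (expChart (ℰ₁ k hist K) ρ) 0) (hC₂ : ∀ k hist K, ContDiffAt ℝ 2 (expChart (ℰ₂ k hist K) ρ) 0)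
    {W : Set (ℕ → ℝ)} {μ ν : Fin 4} {κ : ℝ} (h₁ : WindowedDecay F ℰ₁ ρ bV W μ ν κ) (h₂ : WindowedDecay F ℰ₂ ρ bV W μ ν κ) :
    WindowedDecay F (ℰ₁ + ℰ₂) ρ bV W μ ν κ := by
  intro g hg
  obtain ⟨C₁, hK₁⟩ := h₁ g hg
  obtain ⟨C₂, hK₂⟩ := h₂ g hg
  refine ⟨C₁ + C₂, fun k z => ?_⟩
  filter_upwards [hK₁ k z, hK₂ k z] with K hK1 hK2
  rw [add_apply, polWindow_add F K (k + 1) _ _ ρ bV (hC₁ k _ K) (hC₂ k _ K), add_mul]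
  exact (abs_add_le _ _).trans (add_le_add hK1 hK2)

/-- **UNIFORM WINDOWED (5.10) DECAY** (W1-19c) is additive (`E₁ + E₂`, rate shared). [cite: Balaban1987RG1, (5.10) p.293 and Thm 1 p.259] -/
theorem windowedDecayUniform_add (hC₁ : ∀ k hist K, ContDiffAt ℝ 2 (expChart (ℰ₁ k hist K) ρ) 0) (hC₂ : ∀ k hist K, ContDiffAt ℝ 2 (expChart (ℰ₂ k hist K) ρ) 0)
    {W : Set (ℕ → ℝ)} {E₁ E₂ δ : ℝ} (h₁ : WindowedDecayUniform F ℰ₁ ρ bV W E₁ δ) (h₂ : WindowedDecayUniform F ℰ₂ ρ bV W E₂ δ) :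
    WindowedDecayUniform F (ℰ₁ + ℰ₂) ρ bV W (E₁ + E₂) δ := by
  intro g hg k μ ν z
  filter_upwards [h₁ g hg k μ ν z, h₂ g hg k μ ν z] with K hK1 hK2
  rw [add_apply, polWindow_add F K (k + 1) _ _ ρ bV (hC₁ k _ K) (hC₂ k _ K), add_mul]
  exact (abs_add_le _ _).trans (add_le_add hK1 hK2)

/-- ★ **WINDOWED NE9** (the joint history-Lipschitz bound, eventually in the volume) is additive with moduli `Λ₁ + Λ₂`.
[cite: Balaban1987RG1, (1.18) p.263 and (1.20) p.264] -/
theorem windowedNE9_add (hC₁ : ∀ k hist K, ContDiffAt ℝ 2 (expChart (ℰ₁ k hist K) ρ) 0) (hC₂ : ∀ k hist K, ContDiffAt ℝ 2 (expChart (ℰ₂ k hist K) ρ) 0)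
    {W : Set (ℕ → ℝ)} {κ : ℝ} {Λ₁ Λ₂ : ℕ → ℕ → ℝ} (h₁ : WindowedNE9 F ℰ₁ ρ bV W κ Λ₁) (h₂ : WindowedNE9 F ℰ₂ ρ bV W κ Λ₂) :
    WindowedNE9 F (ℰ₁ + ℰ₂) ρ bV W κ (Λ₁ + Λ₂) := by
  intro g hg g' hg' k μ ν z
  filter_upwards [h₁ g hg g' hg' k μ ν z, h₂ g hg g' hg' k μ ν z] with K hK1 hK2
  rw [add_apply, add_apply, polWindow_add F K (k + 1) _ _ ρ bV (hC₁ k _ K) (hC₂ k _ K),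
    polWindow_add F K (k + 1) _ _ ρ bV (hC₁ k _ K) (hC₂ k _ K)]
  have hsum : Real.exp (-(κ * l1 z)) * ∑ i ∈ Finset.range (k + 1), (Λ₁ + Λ₂) (k + 1) i * |g i - g' i| =
      Real.exp (-(κ * l1 z)) * ∑ i ∈ Finset.range (k + 1), Λ₁ (k + 1) i * |g i - g' i| +
        Real.exp (-(κ * l1 z)) * ∑ i ∈ Finset.range (k + 1), Λ₂ (k + 1) i * |g i - g' i| := by
    rw [← mul_add, ← Finset.sum_add_distrib]
    refine congrArg _ (Finset.sum_congr rfl fun i _ => ?_)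
    simp only [Pi.add_apply, add_mul]
  rw [hsum]
  calc _ = |(polWindow F K (k + 1) (ℰ₁ k (histPrefix g k) K) ρ bV μ ν z - polWindow F K (k + 1) (ℰ₁ k (histPrefix g' k) K) ρ bV μ ν z) +
        (polWindow F K (k + 1) (ℰ₂ k (histPrefix g k) K) ρ bV μ ν z - polWindow F K (k + 1) (ℰ₂ k (histPrefix g' k) K) ρ bV μ ν z)| := by ring_nf
    _ ≤ _ := (abs_add_le _ _).trans (add_le_add hK1 hK2)

/-- ★ **GEOMETRIC INCREMENTS IN THE VOLUME** are additive at a shared ratio `r` (thresholds: the later one; constants add).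
[cite: Balaban1987RG1, (1.21) p.264] -/
theorem geometricIncrements_add (hC₁ : ∀ k hist K, ContDiffAt ℝ 2 (expChart (ℰ₁ k hist K) ρ) 0) (hC₂ : ∀ k hist K, ContDiffAt ℝ 2 (expChart (ℰ₂ k hist K) ρ) 0)
    {W : Set (ℕ → ℝ)} {r : ℝ} (h₁ : GeometricIncrements F ℰ₁ ρ bV W r) (h₂ : GeometricIncrements F ℰ₂ ρ bV W r) :
    GeometricIncrements F (ℰ₁ + ℰ₂) ρ bV W r := by
  intro g hg k μ ν z
  obtain ⟨K₁, C₁, hK₁⟩ := h₁ g hg k μ ν z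
  obtain ⟨K₂, C₂, hK₂⟩ := h₂ g hg k μ ν z
  refine ⟨max K₁ K₂, C₁ + C₂, fun K hK => ?_⟩
  have h1 := hK₁ K (le_of_max_le_left hK)
  have h2 := hK₂ K (le_of_max_le_right hK)
  rw [add_apply, add_apply, polWindow_add F (K + 1) (k + 1) _ _ ρ bV (hC₁ k _ (K + 1)) (hC₂ k _ (K + 1)),
    polWindow_add F K (k + 1) _ _ ρ bV (hC₁ k _ K) (hC₂ k _ K), add_mul]
  calc _ = |(polWindow F (K + 1) (k + 1) (ℰ₁ k (histPrefix g k) (K + 1)) ρ bV μ ν z - polWindow F K (k + 1) (ℰ₁ k (histPrefix g k) K) ρ bV μ ν z) +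
        (polWindow F (K + 1) (k + 1) (ℰ₂ k (histPrefix g k) (K + 1)) ρ bV μ ν z - polWindow F K (k + 1) (ℰ₂ k (histPrefix g k) K) ρ bV μ ν z)| := by
          ring_nf
    _ ≤ _ := (abs_add_le _ _).trans (add_le_add h1 h2)

/-- ★ **THE WINDOWED TWO-RUN STEP RATE ON THE BOXES** is additive (`C'₁ + C'₂`; window radius, volume shift, rate and ratio shared) — the finite-volume input of
node N18's letter. [cite: Balaban1987RG1, Thm 1 p.259 and (1.20)–(1.21) p.264] -/
theorem windowedStepRate_add (hC₁ : ∀ k hist K, ContDiffAt ℝ 2 (expChart (ℰ₁ k hist K) ρ) 0) (hC₂ : ∀ k hist K, ContDiffAt ℝ 2 (expChart (ℰ₂ k hist K) ρ) 0)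
    {γ : ℝ} {s : ℕ} {κ θ C₁ C₂ : ℝ} (h₁ : WindowedStepRate F ℰ₁ ρ bV γ s κ θ C₁) (h₂ : WindowedStepRate F ℰ₂ ρ bV γ s κ θ C₂) :
    WindowedStepRate F (ℰ₁ + ℰ₂) ρ bV γ s κ θ (C₁ + C₂) := by
  intro k w hw μ ν x
  filter_upwards [h₁ k w hw μ ν x, h₂ k w hw μ ν x] with K hK1 hK2
  rw [add_apply, add_apply, polWindow_add F (K + s) (k + 1 + 1) _ _ ρ bV (hC₁ (k + 1) _ (K + s)) (hC₂ (k + 1) _ (K + s)),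
    polWindow_add F K (k + 1) _ _ ρ bV (hC₁ k _ K) (hC₂ k _ K), add_mul, add_mul]
  calc _ = |(polWindow F (K + s) (k + 1 + 1) (ℰ₁ (k + 1) w (K + s)) ρ bV μ ν x - polWindow F K (k + 1) (ℰ₁ k (Fin.tail w) K) ρ bV μ ν x) +
        (polWindow F (K + s) (k + 1 + 1) (ℰ₂ (k + 1) w (K + s)) ρ bV μ ν x - polWindow F K (k + 1) (ℰ₂ k (Fin.tail w) K) ρ bV μ ν x)| := by
          ring_nf
    _ ≤ _ := (abs_add_le _ _).trans (add_le_add hK1 hK2)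

/-- ★★ **NODE N18's LETTER `KernelStepRate` IS ADDITIVE** (`C₅ := C₅¹ + C₅²`; window, rate and ratio shared), given W1-19b's existence letter on the window for both
summands (so that the limiting kernels split, `kernelA_add`; the prepended sequence stays in the window, `prependCoupling_mem_window`).
[cite: Balaban1987RG1, Thm 1 p.259 and (1.20)–(1.22) p.264] -/
theorem kernelStepRate_add (hC₁ : ∀ k hist K, ContDiffAt ℝ 2 (expChart (ℰ₁ k hist K) ρ) 0) (hC₂ : ∀ k hist K, ContDiffAt ℝ 2 (expChart (ℰ₂ k hist K) ρ) 0)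
    {γ κ θ C₁ C₂ : ℝ} (hP₁ : PolLimitsExist F ℰ₁ ρ bV (Window γ)) (hP₂ : PolLimitsExist F ℰ₂ ρ bV (Window γ))
    (h₁ : KernelStepRate F ℰ₁ ρ bV γ κ θ C₁) (h₂ : KernelStepRate F ℰ₂ ρ bV γ κ θ C₂) :
    KernelStepRate F (ℰ₁ + ℰ₂) ρ bV γ κ θ (C₁ + C₂) := by
  intro b hb hbγ g hg k μ ν z
  have hg' : prependCoupling b g ∈ Window γ := prependCoupling_mem_window hb hbγ hg
  rw [kernelA_add_of_polLimitsExist F ℰ₁ ℰ₂ ρ bV hC₁ hC₂ hP₁ hP₂ hg k, kernelA_add_of_polLimitsExist F ℰ₁ ℰ₂ ρ bV hC₁ hC₂ hP₁ hP₂ hg' (k + 1),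
    add_mul, add_mul]
  have h1 := h₁ b hb hbγ g hg k μ ν z
  have h2 := h₂ b hb hbγ g hg k μ ν z
  calc _ = |(kernelA F ℰ₁ ρ bV g k μ ν z - kernelA F ℰ₁ ρ bV (prependCoupling b g) (k + 1) μ ν z) +
        (kernelA F ℰ₂ ρ bV g k μ ν z - kernelA F ℰ₂ ρ bV (prependCoupling b g) (k + 1) μ ν z)| := by
          simp only [Pi.add_apply]; ring_nf
    _ ≤ _ := (abs_add_le _ _).trans (add_le_add h1 h2)

/-- **(D4)'s CLASS LETTER `KernelDecay`** ((5.10)-class membership of the limiting kernels, one constant per sequence, uniformly in the level) is additive, given the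
existence letter on the window for both summands. [cite: Balaban1987RG1, (5.10) p.293 and (1.21) p.264] -/
theorem kernelDecay_add (hC₁ : ∀ k hist K, ContDiffAt ℝ 2 (expChart (ℰ₁ k hist K) ρ) 0) (hC₂ : ∀ k hist K, ContDiffAt ℝ 2 (expChart (ℰ₂ k hist K) ρ) 0)
    {W : Set (ℕ → ℝ)} (hP₁ : PolLimitsExist F ℰ₁ ρ bV W) (hP₂ : PolLimitsExist F ℰ₂ ρ bV W) {μ ν : Fin 4} {κ : ℝ}
    (h₁ : KernelDecay F ℰ₁ ρ bV W μ ν κ) (h₂ : KernelDecay F ℰ₂ ρ bV W μ ν κ) : KernelDecay F (ℰ₁ + ℰ₂) ρ bV W μ ν κ := by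
  intro g hg
  obtain ⟨D₁, hD₁⟩ := h₁ g hg
  obtain ⟨D₂, hD₂⟩ := h₂ g hg
  refine ⟨D₁ + D₂, fun k z => ?_⟩
  rw [kernelA_add_of_polLimitsExist F ℰ₁ ℰ₂ ρ bV hC₁ hC₂ hP₁ hP₂ hg k, Pi.add_apply, Pi.add_apply, Pi.add_apply, add_mul]
  exact (abs_add_le _ _).trans (add_le_add (hD₁ k z) (hD₂ k z))

/-- **W1-19's (UD) DECAY SLOT OF THE KERNEL FUNCTIONAL** is additive: `DecayBound (EA F (ℰ₁ + ℰ₂) ρ bV) W (E₁ + E₂) κ`, given the existence letter on `W` for both.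
[cite: Balaban1987RG1, (1.18) p.263 and (5.10) p.293] -/
theorem decayBound_EA_add (hC₁ : ∀ k hist K, ContDiffAt ℝ 2 (expChart (ℰ₁ k hist K) ρ) 0) (hC₂ : ∀ k hist K, ContDiffAt ℝ 2 (expChart (ℰ₂ k hist K) ρ) 0)
    {W : Set (ℕ → ℝ)} (hP₁ : PolLimitsExist F ℰ₁ ρ bV W) (hP₂ : PolLimitsExist F ℰ₂ ρ bV W) {E₁ E₂ κ : ℝ}
    (h₁ : DecayBound (EA F ℰ₁ ρ bV) W E₁ κ) (h₂ : DecayBound (EA F ℰ₂ ρ bV) W E₂ κ) : DecayBound (EA F (ℰ₁ + ℰ₂) ρ bV) W (E₁ + E₂) κ := by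
  rw [decayBound_EA_iff] at h₁ h₂ ⊢
  intro g hg k μ ν z
  rw [kernelA_add_of_polLimitsExist F ℰ₁ ℰ₂ ρ bV hC₁ hC₂ hP₁ hP₂ hg k, Pi.add_apply, Pi.add_apply, Pi.add_apply, add_mul]
  exact (abs_add_le _ _).trans (add_le_add (h₁ g hg k μ ν z) (h₂ g hg k μ ν z))

/-- **W1-19's NE9 OF THE KERNEL FUNCTIONAL** is additive with moduli `Λ₁ + Λ₂`, given the existence letter on `W` for both. [cite: Balaban1987RG1, (1.18) p.263 and §5 p.298] -/
theorem ne9_EA_add (hC₁ : ∀ k hist K, ContDiffAt ℝ 2 (expChart (ℰ₁ k hist K) ρ) 0) (hC₂ : ∀ k hist K, ContDiffAt ℝ 2 (expChart (ℰ₂ k hist K) ρ) 0)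
    {W : Set (ℕ → ℝ)} (hP₁ : PolLimitsExist F ℰ₁ ρ bV W) (hP₂ : PolLimitsExist F ℰ₂ ρ bV W) {κ : ℝ} {Λ₁ Λ₂ : ℕ → ℕ → ℝ}
    (h₁ : NE9 (EA F ℰ₁ ρ bV) W κ Λ₁) (h₂ : NE9 (EA F ℰ₂ ρ bV) W κ Λ₂) : NE9 (EA F (ℰ₁ + ℰ₂) ρ bV) W κ (Λ₁ + Λ₂) := by
  rw [ne9_EA_iff] at h₁ h₂ ⊢
  intro g hg g' hg' k μ ν z
  rw [kernelA_add_of_polLimitsExist F ℰ₁ ℰ₂ ρ bV hC₁ hC₂ hP₁ hP₂ hg k, kernelA_add_of_polLimitsExist F ℰ₁ ℰ₂ ρ bV hC₁ hC₂ hP₁ hP₂ hg' k]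
  have hsum : Real.exp (-(κ * l1 z)) * ∑ i ∈ Finset.range (k + 1), (Λ₁ + Λ₂) (k + 1) i * |g i - g' i| =
      Real.exp (-(κ * l1 z)) * ∑ i ∈ Finset.range (k + 1), Λ₁ (k + 1) i * |g i - g' i| +
        Real.exp (-(κ * l1 z)) * ∑ i ∈ Finset.range (k + 1), Λ₂ (k + 1) i * |g i - g' i| := by
    rw [← mul_add, ← Finset.sum_add_distrib]
    refine congrArg _ (Finset.sum_congr rfl fun i _ => ?_)
    simp only [Pi.add_apply, add_mul]
  rw [hsum]
  have h1 := h₁ g hg g' hg' k μ ν z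
  have h2 := h₂ g hg g' hg' k μ ν z
  calc _ = |(kernelA F ℰ₁ ρ bV g k μ ν z - kernelA F ℰ₁ ρ bV g' k μ ν z) + (kernelA F ℰ₂ ρ bV g k μ ν z - kernelA F ℰ₂ ρ bV g' k μ ν z)| := by
          simp only [Pi.add_apply]; ring_nf
    _ ≤ _ := (abs_add_le _ _).trans (add_le_add h1 h2)

/-- **W1-19's NE5 AT A FIRST COUPLING `b ∈ ]0, γ]`** is additive on the window `]0, γ]^ℕ` (`C₅¹ + C₅²`), given the existence letter there for both summands
(`U3OfKernels.ne5_iff`: NE5 of the kernel functionals IS the η-rate of consecutive-level limiting kernels). [cite: Balaban1987RG1, Thm 1 p.259 and (1.21) p.264] -/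
theorem ne5_EA_EB_add (hC₁ : ∀ k hist K, ContDiffAt ℝ 2 (expChart (ℰ₁ k hist K) ρ) 0) (hC₂ : ∀ k hist K, ContDiffAt ℝ 2 (expChart (ℰ₂ k hist K) ρ) 0)
    {γ : ℝ} (hP₁ : PolLimitsExist F ℰ₁ ρ bV (Window γ)) (hP₂ : PolLimitsExist F ℰ₂ ρ bV (Window γ)) {b : ℝ} (hb : 0 < b) (hbγ : b ≤ γ)
    {κ θ C₁ C₂ : ℝ} (h₁ : NE5 (EA F ℰ₁ ρ bV) (EB F ℰ₁ ρ bV b) (Window γ) κ θ C₁) (h₂ : NE5 (EA F ℰ₂ ρ bV) (EB F ℰ₂ ρ bV b) (Window γ) κ θ C₂) :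
    NE5 (EA F (ℰ₁ + ℰ₂) ρ bV) (EB F (ℰ₁ + ℰ₂) ρ bV b) (Window γ) κ θ (C₁ + C₂) := by
  rw [ne5_iff] at h₁ h₂ ⊢
  intro g hg k μ ν z
  have hg' : prependCoupling b g ∈ Window γ := prependCoupling_mem_window hb hbγ hg
  rw [kernelA_add_of_polLimitsExist F ℰ₁ ℰ₂ ρ bV hC₁ hC₂ hP₁ hP₂ hg k, kernelA_add_of_polLimitsExist F ℰ₁ ℰ₂ ρ bV hC₁ hC₂ hP₁ hP₂ hg' (k + 1),
    add_mul, add_mul]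
  have h1 := h₁ g hg k μ ν z
  have h2 := h₂ g hg k μ ν z
  calc _ = |(kernelA F ℰ₁ ρ bV g k μ ν z - kernelA F ℰ₁ ρ bV (prependCoupling b g) (k + 1) μ ν z) +
        (kernelA F ℰ₂ ρ bV g k μ ν z - kernelA F ℰ₂ ρ bV (prependCoupling b g) (k + 1) μ ν z)| := by
          simp only [Pi.add_apply]; ring_nf
    _ ≤ _ := (abs_add_le _ _).trans (add_le_add h1 h2)

end Kernels

end YMDAG.N18.KernelLettersSuperposition

end
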